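/-
Copyright (c) 2026 the pub-hodgecm-mathlib formalisation cell (harness21).  Prover seat hodgecm-mathlib-K2Liu-p10 (g7) (S8 hand), Track B ∕ K2-LIT,
h413 = `stmt-HodgeConjecture-24833`, R90-TF section S8 «ContSpec-n½», the (M) «middle residue» road, W8 = (D2) of the (M) :299 column — THE SECTION
DICTIONARY ∘ `Res` AS INTERTWINING MAPS KILLING `K := ker N_v` (S8 dealer R90-CS-plan (g4), S8-R268 (2) ∕ S8-R271; census 2026-09-05T03:53Z).
THEOREMS ONLY (no `def`, no instance, no notation, no `sorry`).
-/
import Summits.HodgeConjecture.HodgeConjecture.Theorems.R90S8LocalIntertwinerRamifiedPlaceU3             -- ★ p865214 (this seat): `localIntertwiner_slot_of_keysOrientation` (+ ★ p865001, ★ Literature `KeysOrientation`)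
import Summits.HodgeConjecture.HodgeConjecture.Theorems.R90S8IntertwiningResidueKernelOfFactorisationU3   -- ★ p864867 (LH4-p10): `residue_dict_equivariant`, `ker_local_le_ker_residue_dict`
import Literature.NumberTheory.Automorphic.ParabolicInductionQuotientProofs                                -- ★ `Subrepresentation.quotientRep`
import HarnessLib

/-!
# S8 (M) road, W8 = (D2): the section dictionary composed with the residue, BUNDLED as intertwining maps `Φ_{φ^v} : I_v(χ_ξ) → σ` killing `K := ker N_v(3∕2)`,
# with `I_v(χ_ξ) ⧸ K` irreducible — the `(K, hK, Φ, hker)` binders of ★ `oneN_at_of_dictionary` (K2E1-p10 (g6), ★ p865166)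

Track B ∕ K2-LIT, crux h413 = `stmt-HodgeConjecture-24833`, route of record `HCCMUnconditional`; cell `hodgecm-mathlib`, R90-TF programme, section S8
«ContSpec-n½», the (M) «middle residue» road of socket B ED. 7 :299, RES-INT line 7 (consumer ★ p865166 `R90S8ResMidOneConstituentOfDictionaryU3.oneN_at_of_dictionary`,
its (D2) binders `(K : Subrepresentation (cmPrincipalSeries …)) (hK : K.quotientRep.IsIrreducible) {ι} (Φ : ι → (cmPrincipalSeries …).IntertwiningMap (ρv.comp e))
(hker : ∀ i, K ≤ (Φ i).ker)`).  Lane `--supports stmt-HodgeConjecture-24833 --as helper` (count-neutral).  CLOSES NO SOCKET.  Dealer «=» S8-R271: `K := f.ker` (Q1 default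
YES), the global data `(T R hT hR Tw Rt hfac)` ABSTRACT at the CM carriers until (D1)'s head is GREEN (Q2).

THE PACKAGE.  In the currency of ★ p864867 (the global block `V` read through a section dictionary `T : I_v ⊗ tails → V`, `G_v`-equivariant in the local slot; the
residue `R = M₋₁ : V → X`, `G_v`-equivariant (★ line 6 p864700); the tensor clause `hfac : R (T xv φt) = Tw (N_v xv) (R^v φt)` = FACT-N's factorisation (★ p864847's
operator form)), the maps `Θ_{φ^v} := R ∘ T(·, φ^v)` ARE intertwining maps `I_v → σ` (★ `residue_dict_equivariant`) and kill `ker N_v` (★ `ker_local_le_ker_residue_dict`).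
With the local factor handed over as an INTERTWINING MAP `f = N_v(3∕2) : I_v(χ_ξ) → τ` (the analytic letter of FACT-N (c-i), UNOWNED; `Nv := f.toLinearMap`) into a
target `τ` without `π²(ξ_v)`-subrepresentations (`hσ`; non-zero, `hf0`), ★ p865214 gives `⊥ ≠ f.ker ≠ ⊤` and `I_v(χ_ξ) ⧸ f.ker ≅ πⁿ(ξ_v)` irreducible — so `K := f.ker`
serves (D2) with `hK` by ★ `Representation.Equiv.isIrreducible_iff` and `hker` by the kernel inequality:
* §1 (generic, any commutative ring ∕ monoid, no `def`): **`exists_dictIntertwiner`** — `∃ Φ : Vt → ρV.IntertwiningMap σ, (∀ φt xv, Φ φt xv = R (T xv φt)) ∧ ∀ φt,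
  ker Nv ≤ ker (Φ φt)`; **`exists_dictIntertwiner_ker_le`** — the same with `Nv := f.toLinearMap` for an intertwining map `f : ρV → τ`, `∀ φt, f.ker ≤ (Φ φt).ker`.
* §2 (the CM data, under `(h : KeysOrientation L)`, the Keys labels, `f`, `hσ`, `hf0`): **`quotientRep_ker_isIrreducible_of_keysOrientation`** — `(f.ker).quotientRep.IsIrreducible`;
  **`dictionary_D2_of_localIntertwiner`** — THE (D2) PACKAGE at `K := f.ker`:
  `f.ker.quotientRep.IsIrreducible ∧ ∃ Φ : Vt → (cmPrincipalSeries …).IntertwiningMap σ, (∀ φt xv, Φ φt xv = R (T xv φt)) ∧ ∀ φt, f.ker ≤ (Φ φt).ker`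
  over ABSTRACT global data `(ρ : Representation ℂ G_v V) (σ : Representation ℂ G_v X) (T R hT hR Tw Rt hfac)` — K2E1-p10 instantiates `σ := ρv.comp e`, `T :=` ★ p864683's
  dictionary, `R := Res` (★ p864700), `hfac :=` ★ p864847, and restricts `Φ` to the live tails `ι := {φt // Rt φt ≠ 0}` if he wants (D3)'s span non-degenerate.
LETTERS VISIBLE AFTER W8 (honest residue of (D2) at a ramified place): `hORIENT` (★ Literature def, UNPROVED), `hσ`, `hf0`, the operator `f = N_v(3∕2)` itself (W3, FACT-N (c-i),
unowned), and the global `(T, R, hT, hR, Tw, Rt, hfac)` + live tails (FACT-N global ∕ RES-INT line 6, other hands).  Elaboration: §2 statements carry the CM carriers (★ p865214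
class: `synthInstance.maxHeartbeats 400000`, `maxHeartbeats 16000000`, measured).
HONEST LABEL: every §2 theorem is CONDITIONAL on `KeysOrientation`; packaging pays no analytic letter; HC_CM is proved only modulo the 7 printed citations (2 remaining
named inputs: hLiu418 = `stmt-HodgeConjecture-24832`, h413 = `stmt-HodgeConjecture-24833`) until rung 0 closes; REL ≠ ★ ≠ BUILT; count-neutral.

## References
* [MoeglinWaldspurger1995] C. Mœglin, J.-L. Waldspurger, *Spectral Decomposition and Eisenstein Series* (1995), II.1.6–II.1.7, IV.1.9–IV.1.11.
* [Langlands1976] R. P. Langlands, *On the Functional Equations Satisfied by Eisenstein Series*, LNM 544 (1976), §6–§7.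
* [Rogawski1990] J. D. Rogawski, Ann. of Math. Stud. 123 (1990), §12.2 (2) pp. 173–174, §13.1 p. 199.
* [BernsteinZelevinsky1976] I. N. Bernstein, A. V. Zelevinsky, Russian Math. Surveys 31:3 (1976), §2.1.
-/

set_option autoImplicit false
set_option linter.dupNamespace false  -- the mandated namespace `…HodgeConjecture.HodgeConjecture.R90.S8` repeats the summit's segment

noncomputable section

open NumberField IsDedekindDomain MeasureTheory
open Literature.NumberTheory Literature.NumberTheory.Automorphic Literature.NumberTheory.Rogawski1990

namespace Summit.HodgeConjecture.HodgeConjecture.R90.S8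

/-! ## §1 The dictionary maps `Θ_{φ^v} = R ∘ T(·, φ^v)` bundled as intertwining maps killing `ker N_v` (generic) -/

section Generic

variable {𝕜 : Type*} [CommRing 𝕜] {Gv : Type*} [Monoid Gv]
variable {Vv Wv Vt Xt V X : Type*} [AddCommGroup Vv] [Module 𝕜 Vv] [AddCommGroup Wv] [Module 𝕜 Wv] [AddCommGroup Vt] [Module 𝕜 Vt]
  [AddCommGroup Xt] [Module 𝕜 Xt] [AddCommGroup V] [Module 𝕜 V] [AddCommGroup X] [Module 𝕜 X]

/-- **THE DICTIONARY MAPS `Θ_{φ^v} = R ∘ T(·, φ^v)` ARE INTERTWINING MAPS `ρV → σ` KILLING `ker N_v`** (★ `residue_dict_equivariant`'s equivariance as a BUNDLED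
`Representation.IntertwiningMap`, built inside the proof — no `def`; the kernel clause is ★ `ker_local_le_ker_residue_dict` under the tensor clause `hfac`).
[cite: MoeglinWaldspurger1995, II.1.6–II.1.7, IV.1.9–IV.1.11] [cite: Langlands1976, §6–§7] -/
theorem exists_dictIntertwiner (ρV : Representation 𝕜 Gv Vv) (ρ : Representation 𝕜 Gv V) (σ : Representation 𝕜 Gv X)
    (T : Vv →ₗ[𝕜] Vt →ₗ[𝕜] V) (Tw : Wv →ₗ[𝕜] Xt →ₗ[𝕜] X) (R : V →ₗ[𝕜] X) (Nv : Vv →ₗ[𝕜] Wv) (Rt : Vt →ₗ[𝕜] Xt)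
    (hT : ∀ (g : Gv) (xv : Vv) (φt : Vt), T (ρV g xv) φt = ρ g (T xv φt)) (hR : ∀ (g : Gv) (v : V), R (ρ g v) = σ g (R v))
    (hfac : ∀ (xv : Vv) (φt : Vt), R (T xv φt) = Tw (Nv xv) (Rt φt)) :
    ∃ Φ : Vt → ρV.IntertwiningMap σ,
      (∀ (φt : Vt) (xv : Vv), Φ φt xv = R (T xv φt)) ∧
      (∀ φt : Vt, LinearMap.ker Nv ≤ LinearMap.ker (Φ φt).toLinearMap) := by
  refine ⟨fun φt => LinearMap.intertwiningMap_of_isIntertwiningMap ρV σ (R ∘ₗ T.flip φt) (fun g xv => ?_), fun _ _ => rfl, fun φt => ?_⟩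
  · simp only [LinearMap.comp_apply, LinearMap.flip_apply, hT, hR]
  · exact ker_local_le_ker_residue_dict T Tw R Nv Rt hfac φt

/-- **… WITH THE LOCAL FACTOR AS AN INTERTWINING MAP `f : ρV → τ`** (`Nv := f.toLinearMap`): `f.ker ≤ (Φ φ^v).ker` as subrepresentations.
[cite: MoeglinWaldspurger1995, IV.1.9–IV.1.11] -/
theorem exists_dictIntertwiner_ker_le {Wτ : Type*} [AddCommGroup Wτ] [Module 𝕜 Wτ] (ρV : Representation 𝕜 Gv Vv) (ρ : Representation 𝕜 Gv V)
    (σ : Representation 𝕜 Gv X) {τ : Representation 𝕜 Gv Wτ}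
    (T : Vv →ₗ[𝕜] Vt →ₗ[𝕜] V) (Tw : Wτ →ₗ[𝕜] Xt →ₗ[𝕜] X) (R : V →ₗ[𝕜] X) (f : ρV.IntertwiningMap τ) (Rt : Vt →ₗ[𝕜] Xt)
    (hT : ∀ (g : Gv) (xv : Vv) (φt : Vt), T (ρV g xv) φt = ρ g (T xv φt)) (hR : ∀ (g : Gv) (v : V), R (ρ g v) = σ g (R v))
    (hfac : ∀ (xv : Vv) (φt : Vt), R (T xv φt) = Tw (f xv) (Rt φt)) :
    ∃ Φ : Vt → ρV.IntertwiningMap σ,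
      (∀ (φt : Vt) (xv : Vv), Φ φt xv = R (T xv φt)) ∧ (∀ φt : Vt, f.ker ≤ (Φ φt).ker) := by
  obtain ⟨Φ, hΦ, hker⟩ := exists_dictIntertwiner ρV ρ σ T Tw R f.toLinearMap Rt hT hR hfac
  exact ⟨Φ, hΦ, fun φt x hx => hker φt hx⟩

end Generic

/-! ## §2 The (D2) package at the data of Keys' case (2), `K := f.ker` -/

section Consumer

set_option synthInstance.maxHeartbeats 400000
set_option maxHeartbeats 16000000 -- section-local («measured», ★ p865001 ∕ ★ p865214): the CM carrier `Gqs L v` vs the matrix carrier of ★ `cmPrincipalSeries` and the `IntertwiningMap`-typed source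

variable {L : Type} [Field L] [NumberField L] [IsCMField L]
  (h : KeysOrientation L) {v : HeightOneSpectrum (𝓞 ↥(maximalRealSubfield L))}
  (hns : ∀ w : UnitaryGroup.PlacesOver L v, IsCMField.complexConj L • w.1 = w.1)
  {μ : (UnitaryGroup.LocalRing L v)ˣ →* ℂˣ}
  {η₁ η₂ : ↥(UnitaryGroup.normOneUnits (UnitaryGroup.conjLocal L (IsCMField.complexConj L) v)) →* ℂˣ}
  (hμ : UnitaryGroup.IsQuadraticCharExtension (UnitaryGroup.conjLocal L (IsCMField.complexConj L) v) μ)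
  (hμc : Continuous (fun x => ((μ x : ℂˣ) : ℂ))) (h1c : Continuous (fun x => ((η₁ x : ℂˣ) : ℂ)))
  (h2c : Continuous (fun x => ((η₂ x : ℂˣ) : ℂ)))
  [MeasurableSpace (Gqs L v ⧸ Subgroup.center (Gqs L v))] [BorelSpace (Gqs L v ⧸ Subgroup.center (Gqs L v))]
  (μZ : Measure (Gqs L v ⧸ Subgroup.center (Gqs L v))) [μZ.IsHaarMeasure]
  {πs πn : IrrClass (Gqs L v)} (hK : KeysCaseTwoLabels L v μ η₁ η₂ πs πn)
  (hs : πs.IsSquareIntegrable μZ) (hn : ¬ πn.IsSquareIntegrable μZ)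
  -- the local factor `f = N_v(3∕2)` (FACT-N (c-i), a letter) into a target `τ` without `π²(ξ_v)`-subrepresentations (`hσ`), non-zero (`hf0`)
  {Wτ : Type*} [AddCommGroup Wτ] [Module ℂ Wτ]
  {τ : Representation ℂ ↥(unitaryGroupOfForm (UnitaryGroup.conjLocal L (IsCMField.complexConj L) v) (UnitaryGroup.cmLocalForm L 3 v)) Wτ}
  (f : (UnitaryGroup.cmPrincipalSeries L 3 v (UnitaryGroup.cmXiTorusChar L v μ η₁ η₂)).IntertwiningMap τ)
  (hσ : ∀ (r : SmoothIrrep (Gqs L v)) (N' : Subrepresentation τ), Nonempty (r.ρ.Equiv N'.toRepresentation) → IrrClass.mk r ≠ πs)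
  (hf0 : f.toLinearMap ≠ 0)

include h hns hμ hμc h1c h2c hK hs hn hσ hf0

/-- **`I_v(χ_ξ) ⧸ ker N_v(3∕2)` IS IRREDUCIBLE** (it carries `πⁿ(ξ_v)`: ★ `localIntertwiner_slot_of_keysOrientation`'s fourth conjunct, transported by ★
`Representation.Equiv.isIrreducible_iff`; `Subrepresentation.quotientRep` is Mathlib's `Representation.quotient` at the `G`-stable submodule) — the `hK` binder of ★
`oneN_at_of_dictionary` at `K := f.ker`. [cite: Rogawski1990, §12.2 (2) pp. 173–174] [cite: BernsteinZelevinsky1976, §2.1] -/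
theorem quotientRep_ker_isIrreducible_of_keysOrientation : f.ker.quotientRep.IsIrreducible := by
  obtain ⟨-, -, -, r, -, ⟨e⟩⟩ := localIntertwiner_slot_of_keysOrientation h hns hμ hμc h1c h2c μZ hK hs hn f hσ hf0
  haveI : r.ρ.IsIrreducible := r.isIrreducible
  exact e.isIrreducible

/-- **THE (D2) PACKAGE AT `K := ker N_v(3∕2)`** — for ABSTRACT global data in ★ p864867's currency (a `G_v`-module `(V, ρ)` = the global block, a `G_v`-module `(X, σ)` = the
residue target, the target dictionary `Tw`, the residue `R : V → X` (`G_v`-equivariant, `hR`), the tail residue `Rt`; then — under the instance ★ `locallyCompactSpace_cmBorelU`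
that lets the carrier of ★ `cmPrincipalSeries` be spelled — a section dictionary `T : I_v(χ_ξ) → tails → V`, `G_v`-equivariant in the local slot (`hT`), with the tensor
clause `hfac : R (T xv φt) = Tw (f xv) (Rt φt)`): `I_v(χ_ξ) ⧸ f.ker` is irreducible and the maps `Θ_{φ^v} = R ∘ T(·, φ^v)` are intertwining maps `I_v(χ_ξ) → σ` killing `f.ker` —
i.e. the `(K, hK, Φ, hker)` binders of ★ `oneN_at_of_dictionary` (its heir instantiates `σ := ρv ∘ e`, `T`, `R`, `hfac`, and restricts `Φ` to the live tails for (D3)).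
[cite: MoeglinWaldspurger1995, II.1.6–II.1.7, IV.1.9–IV.1.11] [cite: Langlands1976, §6–§7] [cite: Rogawski1990, §12.2 (2) pp. 173–174; §13.1 p. 199] -/
theorem dictionary_D2_of_localIntertwiner {Vt Xt V X : Type*} [AddCommGroup Vt] [Module ℂ Vt] [AddCommGroup Xt] [Module ℂ Xt]
    [AddCommGroup V] [Module ℂ V] [AddCommGroup X] [Module ℂ X]
    (ρ : Representation ℂ ↥(unitaryGroupOfForm (UnitaryGroup.conjLocal L (IsCMField.complexConj L) v) (UnitaryGroup.cmLocalForm L 3 v)) V)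
    (σ : Representation ℂ ↥(unitaryGroupOfForm (UnitaryGroup.conjLocal L (IsCMField.complexConj L) v) (UnitaryGroup.cmLocalForm L 3 v)) X)
    (Tw : Wτ →ₗ[ℂ] Xt →ₗ[ℂ] X) (R : V →ₗ[ℂ] X) (Rt : Vt →ₗ[ℂ] Xt)
    (hR : ∀ (g : ↥(unitaryGroupOfForm (UnitaryGroup.conjLocal L (IsCMField.complexConj L) v) (UnitaryGroup.cmLocalForm L 3 v))) (w : V),
      R (ρ g w) = σ g (R w)) :
    haveI := UnitaryGroup.locallyCompactSpace_cmBorelU L 3 v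
    ∀ (T : Representation.SmoothInd (UnitaryGroup.cmBorelTriple L 3 v).P
        (Representation.twist (((Representation.trivial ℂ ↥(UnitaryGroup.torusU (UnitaryGroup.conjLocal L (IsCMField.complexConj L) v)
          (UnitaryGroup.cmLocalForm L 3 v)) ℂ).twist (UnitaryGroup.cmXiTorusChar L v μ η₁ η₂)).comp (UnitaryGroup.cmBorelTriple L 3 v).proj)
          (rootDeltaChar (UnitaryGroup.cmBorelTriple L 3 v).P)) →ₗ[ℂ] Vt →ₗ[ℂ] V),
      (∀ (g : ↥(unitaryGroupOfForm (UnitaryGroup.conjLocal L (IsCMField.complexConj L) v) (UnitaryGroup.cmLocalForm L 3 v))) xv (φt : Vt),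
          T (UnitaryGroup.cmPrincipalSeries L 3 v (UnitaryGroup.cmXiTorusChar L v μ η₁ η₂) g xv) φt = ρ g (T xv φt)) →
      (∀ xv (φt : Vt), R (T xv φt) = Tw (f xv) (Rt φt)) →
      f.ker.quotientRep.IsIrreducible ∧
      ∃ Φ : Vt → (UnitaryGroup.cmPrincipalSeries L 3 v (UnitaryGroup.cmXiTorusChar L v μ η₁ η₂)).IntertwiningMap σ,
        (∀ (φt : Vt) xv, Φ φt xv = R (T xv φt)) ∧ (∀ φt : Vt, f.ker ≤ (Φ φt).ker) := by
  intro T hT hfac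
  exact ⟨quotientRep_ker_isIrreducible_of_keysOrientation h hns hμ hμc h1c h2c μZ hK hs hn f hσ hf0,
    exists_dictIntertwiner_ker_le _ ρ σ T Tw R f Rt hT hR hfac⟩

end Consumer

end Summit.HodgeConjecture.HodgeConjecture.R90.S8

end
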